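import Summits.QuantumFields.YangMills.Theses.TypicalExteriorCeilings
import HarnessLib

/-!
# Route `TypicalExteriorCeilings`: the split glue `VarianceBoundaryLaw → MomentComparability → AnnealedBoundaryLaw` (item stmt-QuantumFields-25922)

The generation-1 split of the deciding crux K1 = `AnnealedBoundaryLaw` (stmt-25891) into V = `VarianceBoundaryLaw` (stmt-25920, the `p = 2`
layer, rate `(C_V/R⁴)²`) and M = `MomentComparability` (stmt-25921, `(E|Ȳ|^p)² ≤ (C_M p^κ)^{2p} (E|Ȳ|²)^p`) glues back by arithmetic:
`ε₀ := min`, `ℓ₁ := min`, `β₁ := max`, `C := C_M·C_V`, `κ := κ_M`; then `(E_p)² ≤ (C_M p^κ)^{2p} (E_2)^p ≤ ((C_M C_V p^κ/R⁴)^p)²` and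
`E_p ≤ |E_p|`, with `E_2 ≥ 0` because `torusE` is an integral of a nonnegative function.  Pure logic + real arithmetic; proves NOTHING about
V, M or K1 themselves, the route's leaf (stmt-19868), `NT`, or the Yang–Mills mass gap.
-/

set_option autoImplicit false

open MeasureTheory
open Literature.MathematicalPhysics.QuantumFieldTheory Literature.MathematicalPhysics.QuantumLattice
open Summit.QuantumFields.YangMills.Cruxes.OSLegsFromFemtoAndGap.DlrCollarTransfer
open Summit.QuantumFields.YangMills.Theses.TypicalExteriorCeilings

namespace Summit.QuantumFields.YangMills.Theorems.TypicalExteriorCeilings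

/-- The arithmetic of the glue: `E₂ ≤ (C_V/R⁴)²` and `E_p² ≤ (C_M p^κ)^{2p} E₂^p` with `E₂ ≥ 0` give `E_p ≤ (C_M C_V p^κ/R⁴)^p`. [folklore] -/
theorem glue_arith {E2 Ep CV CM pk R4 : ℝ} {p : ℕ} (hV : E2 ≤ (CV / R4) ^ 2) (hM : Ep ^ 2 ≤ (CM * pk) ^ (2 * p) * E2 ^ p)
    (hE2 : 0 ≤ E2) (hCV : 0 ≤ CV) (hCM : 0 ≤ CM) (hpk : 0 ≤ pk) (hR4 : 0 < R4) :
    Ep ≤ (CM * CV * pk / R4) ^ p := by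
  have hB0 : 0 ≤ (CM * CV * pk / R4) ^ p := by positivity
  have hsq : ((CM * CV * pk / R4) ^ p) ^ 2 = (CM * pk) ^ (2 * p) * ((CV / R4) ^ 2) ^ p := by
    rw [← pow_mul, ← pow_mul, Nat.mul_comm p 2, ← mul_pow]
    congr 1
    ring
  have h2 : Ep ^ 2 ≤ ((CM * CV * pk / R4) ^ p) ^ 2 := by
    rw [hsq]
    exact hM.trans (mul_le_mul_of_nonneg_left (pow_le_pow_left₀ hE2 hV p) (by positivity))
  exact (le_abs_self Ep).trans (abs_le_of_sq_le_sq h2 hB0)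

section

variable {G : Type} [Group G] [TopologicalSpace G] [IsTopologicalGroup G] [CompactSpace G]
  [MeasurableSpace G] [BorelSpace G] (r : LatticeRep G)

/-- The torus expectation of a pointwise nonnegative observable is nonnegative (`torusE` is an integral). [folklore] -/
theorem torusE_nonneg_of_nonneg (β : ℝ) (L : ℕ) {F : LGConfig 4 G → ℝ} (hF : ∀ V, 0 ≤ F V) : 0 ≤ torusE G r β L F := by
  unfold torusE
  exact integral_nonneg fun U => hF _

end

/-- **The split glue** `VarianceBoundaryLaw → MomentComparability → AnnealedBoundaryLaw` (item stmt-QuantumFields-25922): thresholds by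
`min`/`max`, constants `C := C_M·C_V`, `κ := κ_M`. [folklore] -/
theorem annealedBoundaryLawGlue_proof : AnnealedBoundaryLawGlue := by
  unfold AnnealedBoundaryLawGlue AnnealedBoundaryLaw
  intro hV hM G _ _ _ _ hG hSU
  letI : MeasurableSpace G := borel G
  haveI : BorelSpace G := ⟨rfl⟩
  intro r v f g h Λ₅
  obtain ⟨ε₀V, hε₀V, hV'⟩ := hV G hG hSU r v f g h Λ₅
  obtain ⟨ε₀M, hε₀M, hM'⟩ := hM G hG hSU r v f g h Λ₅
  refine ⟨min ε₀V ε₀M, lt_min hε₀V hε₀M, fun ε hε hεle hfl => ?_⟩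
  obtain ⟨CV, ℓV, βV, hℓV, hCV, hV''⟩ := hV' ε hε (hεle.trans (min_le_left _ _)) hfl
  obtain ⟨CM, κ, ℓM, βM, hℓM, hCM, hκ, hM''⟩ := hM' ε hε (hεle.trans (min_le_right _ _)) hfl
  refine ⟨CM * CV, κ, min ℓV ℓM, max βV βM, lt_min hℓV hℓM, mul_nonneg hCM hCV, hκ,
    fun β hβ s hs hs1 hsub L q x R p hq hR hRs hL hp => ?_⟩
  have hV3 := hV'' β ((le_max_left _ _).trans hβ) s hs hs1 hsub L q x R hq hR (hRs.trans (min_le_left _ _)) hL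
  have hM3 := hM'' β ((le_max_right _ _).trans hβ) s hs hs1 hsub L q x R p hq hR (hRs.trans (min_le_right _ _)) hL hp
  have hR4 : (0 : ℝ) < (R : ℝ) ^ 4 := by positivity
  exact glue_arith hV3 hM3 (torusE_nonneg_of_nonneg r β L fun V => pow_nonneg (abs_nonneg _) 2) hCV hCM
    (Real.rpow_nonneg (Nat.cast_nonneg p) κ) hR4

end Summit.QuantumFields.YangMills.Theorems.TypicalExteriorCeilings
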